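import Literature.NumberTheory.EllipticCurves.ModularCurve
import Literature.NumberTheory.EllipticCurves.QuadraticTwist
import Literature.NumberTheory.EllipticCurves.Isogeny
import Literature.NumberTheory.EllipticCurves.GlobalMinimalModel
import Literature.NumberTheory.DiophantineGeometry.Conductor
import HarnessLib
import HarnessLib.Audit.Tags

/-!
# Candidate E-imc-4: the UNCONDITIONAL degree dichotomy under a ramified twist (`RamifiedTwistDegreeDichotomy p d`)
# and its oriented form (`RamifiedTwistDegreeLawWeak p`)
# — cell `bsd-f2-manin` (D-0131 (3) frontier: the Manin constant at additive primes). `@[conjecture]`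
# leaf (NOTHING asserted; definitions only; proved edges in `RamifiedTwistEdges.lean`).

HONEST FRAMING. LENS = Iwasawa-main-conjecture / Λ-adic integrality read as RAMIFIED-QUADRATIC-TWIST
laws at the additive prime (planner-of-record `bsd-f2-manin-imc`, HOME
`run/shared/lean/pub/bsd-f2-manin/MEMO-imc.md` §§1–5 (sha16 7c7fd3ff00b6a3f6), Props VERBATIM from
HOME/imc/Sketch-imc.lean (namespace `BsdF2ManinImc`, farm rc 0) with its two abbreviations inlined:
`pStar p = (((-1)^(p/2) · p : ℤ) : ℚ)` (`p* = (−1)^{(p−1)/2} p` for odd `p`, the spelling of the tree's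
`ModularParametrizationData.deg_mul_sq_mul_sq_eq_of_quadraticTwist_pStar`) and `IsLatticeOptimal D`
= the lattice clause `Λ_W = c·Λ_f`. «Ramified twist pair at `p`»: `W`, `W′` globally minimal models
of the `X₀(N)`-optimal curves of a class `𝒜` and of `𝒜 ⊗ χ_{p*}` (data `D`, `D′` at the CONDUCTOR
levels with the lattice clauses — refuter-1 traps T1/T2/T3 on BOTH curves), both additive at `p`
(`p² ∣ N`), SAME conductor (automatic for `p ≥ 5` potentially good; a restriction at `p = 3`),
`W′ ~ W ⊗ χ_{p*}`. Lens dictionary and why this is the IMC reading: memo §1 (no Hida family through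
an `a_p = 0` newform; the family is the twist orbit, `R_ψ` plays `U_p`, the «divisibility» is
Edixhoven's index law `[s⁻¹Λ_f : Λ_{f⊗ψ}] ∈ {1, p}`). NOT in print (memo §7; refuter-2 pre-placement
B4/B5): printed twist transports of the Manin `p`-part need the partner SEMISTABLE at `p` (Stevens
1989 §5; tree `ManinConstantQuadraticTwist*`) or settle only the potentially supersingular case
(Edixhoven 1991 §4); Watkins 2002 §2.1 / Delaunay 2003 give the degree identity «if we assume the
Manin constants are the same» (tree PROVED `…deg_mul_sq_mul_sq_eq_of_quadraticTwist_pStar`: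
`D′.deg·D.c²·u² = p·D.deg·D′.c²`, silent on optimality and on `ord_p c`). Data: memo §5 and the
in-seat PAIRWISE TWIST CENSUS v0 (HOME/imc/TWISTCENSUS-v0-N1e5-*, N < 10⁵, 578 278 rows) which
KILLED the v1 forms of IMC-D / IMC-A without `E[p]` irreducible (HOME/CANDIDATES.md §F F-imc-1/3:
50a1 ⊗ χ₅ ≅ 50b3, 5-isogenous to the optimal 50b1). Refuter verdicts: REF1 **SURVIVES** 2026-08-27T14:02Z
(HOME/REFUTER-ref1.md §R1.6: unconditional, fully data-visible, 0 violations over all partner pairs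
N < 10⁵ incl. CM and p ∈ {2, 3}; two engines agree; crux probes BC7 CLEAN); REF2 pending at filing.

THIS ROW (E-imc-4, memo §3 IMC-Δ / IMC-D⁺; planner: «the safest imc row to type first —
unconditional, §B-clean»): for a ramified twist pair of optimal curves at the same level — ALL primes
incl. `2` with `d ∈ {−1, 2, −2}` — `v_p(deg φ₀)` changes by AT MOST one factor of `p` (symmetric; no
orientation, no irreducibility, CM allowed); oriented form at odd `p`: from the member with
`v_p(Δ_min) < 6` the jump is `0` or `+1`. BC5 WITNESS: census v0 (N < 10⁵): 0 exceptions in 578 278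
rows; at `p ≥ 5`: 35 019 oriented pairs at `+1`, 293 at `0`, 0 others. Beyond print: the pairs with
`p ∣ deg φ₀` (ČNS void); in print nowhere (the degree identity of Watkins/Delaunay relates the two
degrees only through the unknown ratio of Manin constants and the twisting-map defect `u`).
-/

noncomputable section

open scoped MatrixGroups ModularForm

open CongruenceSubgroup WeierstrassCurve
  Literature.NumberTheory.EllipticCurves Literature.NumberTheory.EllipticCurves.ModularForms

namespace Summit.BirchSwinnertonDyer.Rank1Residual.ManinAdditive

/-- **Candidate E-imc-4 (i) `RamifiedTwistDegreeDichotomy p d` (cell bsd-f2-manin; a LAW, NOT in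
print, nothing asserted; UNCONDITIONAL form):** for a prime `p`, a twisting discriminant `d`
(`d = p*` for odd `p`; `d ∈ {−1, 2, −2}` at `p = 2`), and a twist pair of `X₀(N)`-optimal curves
`(W, D)`, `(W′, D′)` at the same conductor with `p² ∣ N` and `W′ ~ W ⊗ χ_d`:
`|v_p(deg φ₀(𝒜 ⊗ χ_d)) − v_p(deg φ₀(𝒜))| ≤ 1`, written as two inequalities without subtraction.
[cite: Watkins2002, §2.1 p. 491 (shape only: the degree identity under twists; the dichotomy for OPTIMAL degrees is NOT in print — cell bsd-f2-manin MEMO-imc.md §3 IMC-Δ)] -/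
@[conjecture] def RamifiedTwistDegreeDichotomy (p : ℕ) (d : ℤ) : Prop :=
  ∀ (W W' : WeierstrassCurve ℚ) [W.IsElliptic] [W.IsGloballyMinimal] [W'.IsElliptic]
    [W'.IsGloballyMinimal] [NeZero (W.conductorNorm ℤ)] [NeZero (W'.conductorNorm ℤ)]
    (D : ModularParametrizationData W (W.conductorNorm ℤ))
    (D' : ModularParametrizationData W' (W'.conductorNorm ℤ)),
    p.Prime → ((d : ℚ) = ((((-1 : ℤ) ^ (p / 2) * p : ℤ) : ℚ)) ∨ (p = 2 ∧ (d = -1 ∨ d = 2 ∨ d = -2))) →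
    (∀ z ∈ D.L.lattice, ∃ w ∈ periodLattice D.f, z = D.c * w) →
    (∀ z ∈ D'.L.lattice, ∃ w ∈ periodLattice D'.f, z = D'.c * w) →
    p ^ 2 ∣ W.conductorNorm ℤ → W'.conductorNorm ℤ = W.conductorNorm ℤ →
    IsIsogenous (W.quadraticTwist (d : ℚ)) W' →
    padicValNat p D'.modularDegree ≤ padicValNat p D.modularDegree + 1 ∧
    padicValNat p D.modularDegree ≤ padicValNat p D'.modularDegree + 1

/-- **Candidate E-imc-4 (ii) `RamifiedTwistDegreeLawWeak p` (cell bsd-f2-manin; the ORIENTED form at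
odd `p`, no irreducibility, nothing asserted):** for a ramified twist pair of optimal curves at the
odd prime `p` whose classes differ (`¬ IsIsogenous W W′`: excludes CM by `ℚ(√p*)`), oriented by
`v_p(Δ_min(W)) < 6`: the jump of `v_p(deg φ₀)` from `𝒜` to `𝒜 ⊗ χ_{p*}` is `+1` or `0` (never `−1`,
never `+2`).
[cite: Watkins2002, §2.1 p. 491 (shape only; the oriented law for optimal degrees is NOT in print — cell bsd-f2-manin MEMO-imc.md §3 IMC-D⁺)] -/
@[conjecture] def RamifiedTwistDegreeLawWeak (p : ℕ) : Prop :=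
  ∀ (W W' : WeierstrassCurve ℚ) [W.IsElliptic] [W.IsGloballyMinimal] [W'.IsElliptic]
    [W'.IsGloballyMinimal] [NeZero (W.conductorNorm ℤ)] [NeZero (W'.conductorNorm ℤ)]
    (D : ModularParametrizationData W (W.conductorNorm ℤ))
    (D' : ModularParametrizationData W' (W'.conductorNorm ℤ)),
    p.Prime → p ≠ 2 →
    (∀ z ∈ D.L.lattice, ∃ w ∈ periodLattice D.f, z = D.c * w) →
    (∀ z ∈ D'.L.lattice, ∃ w ∈ periodLattice D'.f, z = D'.c * w) →
    p ^ 2 ∣ W.conductorNorm ℤ → W'.conductorNorm ℤ = W.conductorNorm ℤ →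
    IsIsogenous (W.quadraticTwist ((((-1 : ℤ) ^ (p / 2) * p : ℤ) : ℚ))) W' →
    ¬ IsIsogenous W W' →
    padicValInt p W.minimalDiscriminantInt < 6 →
    padicValNat p D'.modularDegree = padicValNat p D.modularDegree + 1 ∨
    padicValNat p D'.modularDegree = padicValNat p D.modularDegree

end Summit.BirchSwinnertonDyer.Rank1Residual.ManinAdditive

end
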